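import Summits.BirchSwinnertonDyer.Rank1Residual.X11b.AnticyclotomicTamagawa
import Summits.BirchSwinnertonDyer.Rank1Residual.X11b.RouteR1
import HarnessLib

/-!
# X11b, route R1 — the open input re-based on Castella's display (5.2) (its `N⁺`-Tamagawa term on
# tree objects); the step (5.2) ⟹ (5.3) is now a THEOREM; the statement of record with that input

HONEST FRAMING (cell `b2b-bsdres`, run/shared/lean/b2b/bsd-rank1-residual/, verbatim in every
file): the goal of the cell is to DELETE the COMBINATION-SHAPED residual classes of the
Birch–Swinnerton-Dyer formula for ALL analytic-rank `≤ 1` elliptic curves over `ℚ` — "full BSD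
formula for every rank `≤ 1` curve in class `C`" assembled STRICTLY from published theorems — so
that the rank-`≤ 1` remainder becomes exactly the CONSTRUCTION-SHAPED classes, which are TYPED
(missing-input `Prop`s), NOT attempted. This is not "finishing BSD". Sub-cell
`b2b-bsdres-multr1-p1` (X11b, route R1); a RESEARCH ROUTE; no claim beyond the stated class; X11b
stays CONSTRUCTION-SHAPED; nothing here changes a label; no named fact (two `Prop`-valued predicates
with parameters naming an OPEN shape, and theorems; every result using the open shape is
CONDITIONAL; no `sorry`).

## Content

Castella, Camb. J. Math. 6 (2018) §5 (arXiv:1704.06608 p. 12): "Theorem 2.3 (taking `Σ = ∅` and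
`P = P_K`) yields a formula for `#ℤ_p/f_ac(0)` that combined with (5.1) immediately leads to
  `ord_p(#Ш(E/K)[p^∞]) = 2 · ord_p([E(K) : ℤ.P_K]) − Σ_{w ∣ N⁺} ord_p(c_w(E/K))`.      (5.2)
… Since `E[p]` is ramified at `q`, we have `ord_p(c_w(E/K)) = 0` for every prime `w ∣ q` … Hence,
(5.2) can be rewritten as `ord_p(#Ш(E/K)[p^∞]) = 2 · ord_p([E(K):ℤ.P_K]) − Σ_{w∣N} ord_p(c_w(E/K))`
(5.3)". Until gen 7 the open input of route R1 was (5.3) (`Display53At`, `R1OpenInputAt`), because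
the `N⁺`-Tamagawa term of (5.2) had no tree object. `AnticyclotomicTamagawa.lean` (this gen) defines
`tamagawaProductSplit W K = ∏_{w ∣ N⁺} c_w(E/K)` and PROVES the step (5.2) ⟹ (5.3) on every erratum
field (`padicValNat_tamagawaProductSplit_eq_of_isErratumField`). Hence:

* `Display52At W p K P` — Castella's (5.2) at `(E, p, K, P)` ON TREE OBJECTS (the direct output of
  (IMC) ∘ (BDP) ∘ (CTL), before the elementary Tamagawa step); `display53At_of_display52At` — (5.2)
  ⟹ (5.3) on an erratum field (THEOREM); `display52At_of_realLinks` — (IMC@𝟙)ʳ [OPEN] ∘ (BDP) ∘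
  (CTL)ʳ [PUB shapes] ⟹ (5.2), for a shadow whose Tamagawa field is the defined `N⁺`-valuation (no
  (TAM-q) input at all).
* `R1OpenInput52At W p` — the open input of route R1 with (5.2) in place of (5.3), same binders as
  `R1OpenInputAt` (erratum field `K` for an odd… any non-split multiplicative `q` with `E[p]`
  ramified, `Cas20Standing`, Heegner datum with `p ∤ c`, `P` of infinite order) — a WEAKER open
  input: **`r1OpenInputAt_of_r1OpenInput52At`** derives gen 7's `R1OpenInputAt W p` from it by the
  theorem above. `[claim: Castella2018Erratum, status: under-review]`, NEVER a theorem.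
* **`R1.bsdp_of_openInput52`** — the statement of record `R1.bsdp` (NINE published named facts) fed
  with `∀ W p, R1OpenInput52At W p`: `BSD(E,p)` on `R1Population` at `r_an = 1`. The printed
  derivation of the remaining open input is now exactly [erratum Thm. 1.1 (UNREFEREED ⇐ FW21
  Thm. 4.41)] ∘ [Cas18 Thm. 3.2 (PUB)] ∘ [Cas18 Thm. 2.3 (PUB)] at the datum — its algebraic side on
  the constructed `X_ac(E[p^∞])` (`AnticyclotomicLinks`), its Tamagawa term on tree objects.

CONDITIONAL on the open input; deletes nothing; X11b stays CONSTRUCTION-SHAPED; no label change.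

References: [Castella2018] §5 (5.1)–(5.3) (arXiv:1704.06608 p. 12), Thm. 2.3, Thm. 3.2;
[Castella2018Erratum] Thm. 1.1, Thm. A′ (p. 1); [Castella2020JIMJ] §2.5, Thm. 2.11.
-/

noncomputable section

open scoped Classical

open WeierstrassCurve NumberField IsDedekindDomain Literature.NumberTheory.EllipticCurves
  Literature.NumberTheory.EllipticCurves.ModularForms
  Literature.NumberTheory.EllipticCurves.Rank1Residual
  Literature.NumberTheory.EllipticCurves.Rank1Residual.Typed
  Summit.BirchSwinnertonDyer.Rank1Residual.X11b.AcSelmer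

namespace Summit.BirchSwinnertonDyer.Rank1Residual.X11b

/-! ### Castella's (5.2) on tree objects and the step (5.2) ⟹ (5.3) -/

section Display

variable (W : WeierstrassCurve ℚ) (p : ℕ) [Fact p.Prime] (K : Type) [Field K] [NumberField K]

/-- **Cas18 eq. (5.2) at `(E, p, K, P)` ON TREE OBJECTS — OPEN ∘ PUB:**
"`ord_p(#Ш(E/K)[p^∞]) = 2 · ord_p([E(K) : ℤ.P_K]) − Σ_{w ∣ N⁺} ord_p(c_w(E/K))`" (arXiv:1704.06608
p. 12), with `Σ_{w ∣ N⁺} ord_p c_w = ord_p (tamagawaProductSplit W K)` (`AnticyclotomicTamagawa`). The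
direct output of (IMC at `𝟙`, erratum Thm. 1.1 — UNREFEREED) ∘ (Cas18 Thm. 3.2, PUB) ∘ (Cas18 Thm. 2.3,
PUB) at the Heegner point. A predicate; NEVER a theorem. [claim: Castella2018Erratum, status: under-review]
[cite: Castella2018, §5 (5.2) (arXiv:1704.06608 p. 12) (shape only; nothing asserted)] -/
def Display52At (P : (W.baseChange K).toAffine.Point) : Prop :=
  (padicValNat p (Nat.card (AddCommGroup.primaryComponent (W.baseChange K).sha p)) : ℤ) =
    2 * (padicValNat p (AddSubgroup.zmultiples P).index : ℤ) -
      padicValNat p (tamagawaProductSplit W K)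

variable {W p K}

/-- **(5.2) ⟹ (5.3) is a THEOREM on an erratum field** ("Since `E[p]` is ramified at `q`, we have
`ord_p(c_w(E/K)) = 0` for every prime `w ∣ q` … (5.2) can be rewritten as (5.3)"): for `W/ℚ` globally
minimal elliptic, `p ≥ 5`, `q` multiplicative with `p ∤ ord_q Δ_min`, `K` an erratum field for `q`,
`Display52At ⟹ Display53At` by `padicValNat_tamagawaProductSplit_eq_of_isErratumField`.
[cite: Castella2018, §5, from (5.2) to (5.3) (arXiv:1704.06608 p. 12)] -/
theorem display53At_of_display52At [W.IsElliptic] [W.IsGloballyMinimal] (hp : 5 ≤ p) {q : ℕ}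
    [Fact q.Prime] (hmq : Mult W q) (hvq : ¬ p ∣ padicValInt q W.minimalDiscriminantInt)
    (hK : IsErratumField W K q) {P : (W.baseChange K).toAffine.Point} (h : Display52At W p K P) :
    Display53At W p K P := by
  unfold Display52At at h
  unfold Display53At
  rw [padicValNat_tamagawaProductSplit_eq_of_isErratumField W p K hp q hmq hvq hK] at h
  exact h

/-- Conversely (5.3) ⟹ (5.2) on an erratum field (the two displays are equivalent there).
[cite: Castella2018, §5, (5.2)–(5.3) (arXiv:1704.06608 p. 12)] -/
theorem display52At_iff_display53At [W.IsElliptic] [W.IsGloballyMinimal] (hp : 5 ≤ p) {q : ℕ}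
    [Fact q.Prime] (hmq : Mult W q) (hvq : ¬ p ∣ padicValInt q W.minimalDiscriminantInt)
    (hK : IsErratumField W K q) {P : (W.baseChange K).toAffine.Point} :
    Display52At W p K P ↔ Display53At W p K P := by
  unfold Display52At Display53At
  rw [padicValNat_tamagawaProductSplit_eq_of_isErratumField W p K hp q hmq hvq hK]

/-- **(5.2) from the real links, with NO Tamagawa input**: for a shadow at `(E,p,K,P)` whose field
`tamSplitOrd` is the defined `ord_p ∏_{w∣N⁺} c_w(E/K)`, (IMC@𝟙)ʳ [OPEN] ∘ (BDP) ∘ (CTL)ʳ [PUB shapes]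
⟹ `Display52At W p K P` ("combined with (5.1) immediately leads to (5.2)"). The two `f_ac`-witnesses
are identified by `XAc.HasCharValuationAt.unique`. CONDITIONAL on (IMC@𝟙)ʳ.
[cite: Castella2018, §5 (5.1)–(5.2) (arXiv:1704.06608 p. 12)] [cite: Castella2018Erratum, Thm. 1.1 (p. 1)] -/
theorem display52At_of_realLinks {P : (W.baseChange K).toAffine.Point} (κ : ZpExtension K p)
    (𝔭 : HeightOneSpectrum (𝓞 K)) (γ : Field.absoluteGaloisGroup K) [Fact (κ.IsTopGenerator γ)]
    (S : LambdaAdicShadow W K P) (hS : S.tamSplitOrd = padicValNat p (tamagawaProductSplit W K))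
    (hIMC : S.IMCAtTrivialCharReal p κ 𝔭 γ) (hBDP : S.WaldspurgerAt) (hCTL : S.ControlAtReal p κ 𝔭 γ) :
    Display52At W p K P := by
  obtain ⟨n, hn, hne⟩ := hIMC
  obtain ⟨n', hn', hne'⟩ := hCTL
  obtain rfl : n = n' := hn.unique hn'
  unfold LambdaAdicShadow.WaldspurgerAt at hBDP
  unfold Display52At
  rw [← hS]
  omega

end Display

/-! ### Route R1's open input with (5.2), and the statement of record fed with it -/

section Route

/-- **The open input of route R1 at the pair, (5.2)-FORM — "(A52|VoR)"**: Castella's display (5.2)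
(`Display52At`, `N⁺`-Tamagawa term on tree objects) at the Heegner point `P` (of infinite order) of a
modular parametrisation datum of level `N_E` with `p ∤ c`, on the A′-hypotheses with `r_an = 1`, for
every non-split multiplicative `q ≠ p` with `p ∤ v_q(Δ_min)` and every ERRATUM FIELD `K` for `q` meeting
[Cas20, §2.5]'s standing hypotheses at the tame level (`Cas20Standing`) — the binders of gen 7's
`R1OpenInputAt` verbatim, the conclusion one printed step EARLIER. Printed derivation: [erratum
Thm. 1.1, UNREFEREED ⇐ FW21 Thm. 4.41] ∘ [Cas18 Thm. 3.2, PUB] ∘ [Cas18 Thm. 2.3, PUB]. WEAKER than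
`R1OpenInputAt` as an assumption (`r1OpenInputAt_of_r1OpenInput52At`). A predicate on `(W, p)`;
NEVER a theorem. [claim: Castella2018Erratum, status: under-review] -/
def R1OpenInput52At (W : WeierstrassCurve ℚ) [W.IsElliptic] [W.IsGloballyMinimal] (p : ℕ)
    [Fact p.Prime] : Prop :=
  ∀ [NeZero (W.conductorNorm ℤ)] (q : ℕ) [Fact q.Prime] (K : Type) [Field K] [NumberField K]
    (Dt : ModularParametrizationData W (W.conductorNorm ℤ))
    (H : HeegnerDatum (W.conductorNorm ℤ) (NumberField.discr K)) (ι : K →+* ℂ)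
    (P : (W.baseChange K).toAffine.Point),
    ErratumHypotheses W p → W.analyticRank = 1 → q ≠ p → Mult W q →
    ¬ W.HasSplitMultiplicativeReductionAtPrime q → ¬ p ∣ padicValInt q W.minimalDiscriminantInt →
    IsErratumField W K q → Cas20Standing K p (W.conductorNorm ℤ / p) →
    WeierstrassCurve.Affine.Point.map ι.toRatAlgHom P = heegnerPointComplex Dt H →
    ¬ (p : ℤ) ∣ Dt.c → ¬ IsOfFinAddOrder P → Display52At W p K P

/-- **(A52|VoR) ⟹ (A|VoR)**: the (5.2)-form of the open input implies gen 7's (5.3)-form, by the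
THEOREM `display53At_of_display52At` (`p ≥ 5` from the A′-hypotheses, `q` multiplicative with `E[p]`
ramified and `K` an erratum field from the binders). [cite: Castella2018, §5, from (5.2) to (5.3) (arXiv:1704.06608 p. 12)] -/
theorem r1OpenInputAt_of_r1OpenInput52At {W : WeierstrassCurve ℚ} [W.IsElliptic]
    [W.IsGloballyMinimal] {p : ℕ} [Fact p.Prime] (h : R1OpenInput52At W p) : R1OpenInputAt W p := by
  intro _ q _ K _ _ Dt H ι P hE hr hqp hmq hns hvq hK hCas hP hc hinf
  exact display53At_of_display52At hE.1 hmq hvq hK (h q K Dt H ι P hE hr hqp hmq hns hvq hK hCas hP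
    hc hinf)

/-- **Route R1 — statement of record with the (5.2)-form open input.** For every globally minimal
elliptic `W/ℚ` and prime `p` on `R1Population` with `ord_{s=1} L(E,s) = 1`: `BSD(E,p)`, from the NINE
PUBLISHED named facts of `R1.bsdp` (Gross–Zagier 1986 I.7.3, GZK, Skinner 2016 Thm. C, modularity,
Cai–Shu–Tian 2014 Thm. 1.1, Friedberg–Hoffstein 1995 Thm. B, Mazur 1978 Cor. 4.1, Néron mapping
property) and the OPEN input `∀ W p, R1OpenInput52At W p` — Castella's (5.2) at the Heegner data of
erratum fields (⇐ erratum Thm. 1.1 ∘ Cas18 Thms. 3.2, 2.3); the step to (5.3) is the theorem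
`display53At_of_display52At`. CONDITIONAL; deletes nothing; X11b stays CONSTRUCTION-SHAPED.
[cite: Castella2018, §5 (arXiv:1704.06608 p. 12)] [cite: Castella2018Erratum, Thm. 1.1, Thm. A′ (p. 1)]
[cite: Castella2020JIMJ, §2.5 (author PDF p. 8) and Thm. 2.11 (p. 12)] -/
theorem R1.bsdp_of_openInput52
    (hGZ : GrossZagier1986_thm_I_7_3) (hGZK : rank_eq_analyticRank_of_analyticRank_le_one)
    (hSk : Skinner2016.thmC_padicValRat_bsd_rank_zero) (hmod : exists_isNewformOf)
    (hCST : CaiShuTian2014.thm11_trivialChar)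
    (hFH : friedbergHoffstein_exists_twist_ne_zero_ramifiedAt)
    (hMaz : mazur_not_dvd_maninConstant_of_odd) (hNS : integral_neronScaling_of_isGloballyMinimal)
    (hA52 : ∀ (W : WeierstrassCurve ℚ) [W.IsElliptic] [W.IsGloballyMinimal] (p : ℕ) [Fact p.Prime],
      R1OpenInput52At W p)
    (W : WeierstrassCurve ℚ) [W.IsElliptic] [W.IsGloballyMinimal] (p : ℕ) [Fact p.Prime]
    (hW : R1Population W p) (hr : W.analyticRank = 1) : BSDp W p :=
  R1.bsdp hGZ hGZK hSk hmod hCST hFH hMaz hNS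
    (fun W _ _ p _ ↦ r1OpenInputAt_of_r1OpenInput52At (hA52 W p)) W p hW hr

end Route

end Summit.BirchSwinnertonDyer.Rank1Residual.X11b

end
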